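import Mathlib
import HarnessLib

/-!
# Counter strategies I — law calculus on a finite state space and the `(g, a, b)`-model of α's u-walk game

Planner qa-qnc0-p2 g15, ROUND-15 (p2) §3.15 ADDENDUM 2 (R13 window-free, `WalkHardFCounterSharp`): the proof runs on
LAWS (counting measures `μ : S → ℝ`) of a finite-state process.  This file is the strategy-free part:

§1 LAW CALCULUS on a `Fintype` `S`: the square mass `Q μ = Σ μ²`, the `ℓ¹` distance, invariance under bijections,
   the PARALLELOGRAM identity for an average of two laws (`Q_avg`), Cauchy–Schwarz in the two forms used
   (`sq_l1_le`, `sq_sum_le_card_mul_Q`), and the iterated-shift bound `l1_iterate_le`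
   (`‖μ − e^k μ‖₁ ≤ k‖μ − e μ‖₁`).
§2 THE MODEL `S p = V₄ × ℤ/3 × ℤ/p`: register `g ∈ V₄` realised as `Bool × Bool` (`ev g s`, `s : ZMod 3`, third value the
   XOR), label `a` (`= t + W_{<t} mod 3`), counter `b` (`= W_{<t} mod p`); a fire at label `a` toggles `g ↦ g + (𝟙 − δ_a)`
   (`tog`), a bit `β` moves `(g, a, b) ↦ (g, a + 1 + β, b + β)`; the shift `shK k : (g,a,b) ↦ (g, a+k, b+k)`.
§3 THE TRANSLATE FAMILY `𝓛 = {L_{κ,ε}}` (12 sets; index `Idx = ZMod 3 × Option (ZMod 3)`, `ε = 0` or `1 − δ_r`):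
   `(g,a) ∈ L_{κ,ε} ⟺ ev g (κ − a) = ε a`; closed under label shifts (`mem_shIdx`) and toggles (`mem_togIdx`), and every
   member meets every `⟨γ⟩`-coset `{(g, a) : a}` (`exists_mem_idx`) — the "two-block lemma".  All by `decide`.
§4 THE MONOTONE FUNCTIONAL `Φ μ = Σ_b min_{L ∈ 𝓛} μ(L × {b})`: `ℓ¹`-Lipschitz (`abs_phi_sub_phi_le`), invariant under
   fibre-wise toggling (`phi_fire`), non-decreasing under the bit step (`phi_bit_le`), and `≥ (total mass)/3` on laws
   whose fibres are constant in the label (`phi_ge_third`).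
WHAT THIS IS NOT: no statement about strategies here (see `CounterStrategies.lean`); instrument; separation NOT moved.
-/

namespace Summit.QuantumAdvantage.AdviceFreeQNC0.CounterLaw

open Finset

/-! ## §1 Law calculus on a finite state space -/

section Calculus

variable {S : Type*} [Fintype S]

/-- square mass `Q μ = Σ_x μ(x)²`. -/
def Q (μ : S → ℝ) : ℝ := ∑ x, μ x ^ 2

/-- `ℓ¹` distance `Σ_x |μ x − ν x|`. -/
def l1 (μ ν : S → ℝ) : ℝ := ∑ x, |μ x - ν x|

/-- `Q` is invariant under reindexing by a bijection. -/
theorem Q_comp_equiv (e : S ≃ S) (μ : S → ℝ) : Q (fun x => μ (e x)) = Q μ := by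
  unfold Q; exact Equiv.sum_comp e (fun x => μ x ^ 2)

/-- `l1` is nonnegative. -/
theorem l1_nonneg (μ ν : S → ℝ) : 0 ≤ l1 μ ν := sum_nonneg fun _ _ => abs_nonneg _

/-- `l1` is symmetric. -/
theorem l1_comm (μ ν : S → ℝ) : l1 μ ν = l1 ν μ := by
  unfold l1; exact sum_congr rfl fun _ _ => abs_sub_comm _ _

/-- triangle inequality for `l1`. -/
theorem l1_triangle (μ ν ρ : S → ℝ) : l1 μ ρ ≤ l1 μ ν + l1 ν ρ := by
  unfold l1; rw [← sum_add_distrib]; exact sum_le_sum fun _ _ => abs_sub_le _ _ _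

/-- `l1` is invariant under reindexing by a bijection. -/
theorem l1_comp_equiv (e : S ≃ S) (μ ν : S → ℝ) :
    l1 (fun x => μ (e x)) (fun x => ν (e x)) = l1 μ ν := by
  unfold l1; exact Equiv.sum_comp e (fun x => |μ x - ν x|)

/-- **PARALLELOGRAM**: the square mass of an average of two laws. -/
theorem Q_avg (μ ν : S → ℝ) :
    Q (fun x => (μ x + ν x) / 2) = (Q μ + Q ν) / 2 - (∑ x, (μ x - ν x) ^ 2) / 4 := by
  have h1 : Q (fun x => (μ x + ν x) / 2) = ∑ x, ((μ x ^ 2 + ν x ^ 2) / 2 - (μ x - ν x) ^ 2 / 4) :=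
    sum_congr rfl fun x _ => by dsimp only; ring
  rw [h1, sum_sub_distrib, ← sum_div, ← sum_div, sum_add_distrib]
  rfl

/-- **Cauchy–Schwarz**, `ℓ¹` versus `ℓ²`: `(Σ|μ−ν|)² ≤ |S|·Σ(μ−ν)²`. -/
theorem sq_l1_le (μ ν : S → ℝ) : l1 μ ν ^ 2 ≤ Fintype.card S * ∑ x, (μ x - ν x) ^ 2 := by
  have h := Finset.sum_mul_sq_le_sq_mul_sq (Finset.univ : Finset S) (fun _ => (1 : ℝ)) (fun x => |μ x - ν x|)
  simp only [one_mul, one_pow, sum_const, card_univ, nsmul_eq_mul, mul_one, sq_abs] at h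
  unfold l1; exact h

/-- **Cauchy–Schwarz**, mass versus square mass: `(Σ μ)² ≤ |S|·Q μ`. -/
theorem sq_sum_le_card_mul_Q (μ : S → ℝ) : (∑ x, μ x) ^ 2 ≤ Fintype.card S * Q μ := by
  have h := Finset.sum_mul_sq_le_sq_mul_sq (Finset.univ : Finset S) (fun _ => (1 : ℝ)) μ
  simp only [one_mul, one_pow, sum_const, card_univ, nsmul_eq_mul, mul_one] at h
  unfold Q; exact h

/-- iterated shifts: `‖μ − μ∘(e^k)⁻¹‖₁ ≤ k·‖μ − μ∘e⁻¹‖₁` (telescoping + invariance). -/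
theorem l1_iterate_le (e : S ≃ S) (μ : S → ℝ) (k : ℕ) :
    l1 μ (fun x => μ ((e ^ k).symm x)) ≤ k * l1 μ (fun x => μ (e.symm x)) := by
  induction k with
  | zero =>
    unfold l1
    simp only [pow_zero, Nat.cast_zero, zero_mul]
    refine le_of_eq (Finset.sum_eq_zero fun x _ => ?_)
    rw [show (1 : S ≃ S).symm x = x from rfl, sub_self, abs_zero]
  | succ k ih =>
    have step : l1 (fun x => μ ((e ^ k).symm x)) (fun x => μ ((e ^ (k + 1)).symm x))
        = l1 μ (fun x => μ (e.symm x)) := by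
      have h := l1_comp_equiv (e ^ k) (fun x => μ ((e ^ k).symm x)) (fun x => μ ((e ^ (k + 1)).symm x))
      rw [← h]
      unfold l1
      refine sum_congr rfl fun x _ => ?_
      simp only [Equiv.symm_apply_apply, pow_succ, Equiv.Perm.mul_def, Equiv.symm_trans_apply]
    calc l1 μ (fun x => μ ((e ^ (k + 1)).symm x))
        ≤ l1 μ (fun x => μ ((e ^ k).symm x)) + l1 (fun x => μ ((e ^ k).symm x)) (fun x => μ ((e ^ (k + 1)).symm x)) :=
          l1_triangle _ _ _
      _ ≤ k * l1 μ (fun x => μ (e.symm x)) + l1 μ (fun x => μ (e.symm x)) := by rw [step]; linarith [ih]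
      _ = (k + 1 : ℕ) * l1 μ (fun x => μ (e.symm x)) := by push_cast; ring

end Calculus

/-! ## §2 The model: register `V₄` as `Bool × Bool`, label `ZMod 3`, counter `ZMod p` -/

/-- the register `g ∈ V₄ ≅ (ℤ/2)²` evaluated at `s : ZMod 3` (`g(2) = g(0) ⊕ g(1)`: even-weight vectors of `(ℤ/2)³`). -/
def ev (g : Bool × Bool) (s : ZMod 3) : Bool :=
  if s = 0 then g.1 else if s = 1 then g.2 else xor g.1 g.2

/-- a fire at label `a`: `g ↦ g + (𝟙 − δ_a)` (flip every coordinate except `a`). -/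
def tog (a : ZMod 3) (g : Bool × Bool) : Bool × Bool :=
  (xor g.1 (decide (a ≠ 0)), xor g.2 (decide (a ≠ 1)))

/-- `ev (tog a g) s = ev g s ⊕ [s ≠ a]`. -/
theorem ev_tog (a : ZMod 3) (g : Bool × Bool) (s : ZMod 3) : ev (tog a g) s = xor (ev g s) (decide (s ≠ a)) := by
  revert a g s; decide

/-- toggling twice is the identity. -/
theorem tog_tog (a : ZMod 3) (g : Bool × Bool) : tog a (tog a g) = g := by
  revert a g; decide

/-- two registers with the same evaluations are equal. -/
theorem ev_injective (g g' : Bool × Bool) (h : ∀ s, ev g s = ev g' s) : g = g' := by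
  have h0 := h 0; have h1 := h 1
  simp only [ev, if_true] at h0
  simp only [ev, one_ne_zero, if_false, if_true] at h1
  exact Prod.ext h0 h1

variable (p : ℕ)

/-- the state space `V₄ × ℤ/3 × ℤ/p` (`12p` states). -/
abbrev St := (Bool × Bool) × ZMod 3 × ZMod p

/-- `|St p| = 12 p`. -/
theorem card_St [NeZero p] : Fintype.card (St p) = 12 * p := by
  simp only [St, Fintype.card_prod, Fintype.card_bool, ZMod.card]; ring

/-- the simultaneous shift of label and counter by `k`: `(g, a, b) ↦ (g, a + k, b + k)` (`k = 1`: the last-bit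
involution `Δ`; `k = p`: a pure label rotation). -/
def shK (k : ℕ) : St p ≃ St p where
  toFun x := (x.1, x.2.1 + k, x.2.2 + k)
  invFun x := (x.1, x.2.1 - k, x.2.2 - k)
  left_inv x := by simp
  right_inv x := by simp

/-- the inverse shift. -/
theorem shK_symm_apply (k : ℕ) (x : St p) : (shK p k).symm x = (x.1, x.2.1 - k, x.2.2 - k) := rfl

/-- `shK (k+1) = shK k ∘ shK 1` as a power: `shK k = (shK 1)^k`. -/
theorem shK_eq_pow (k : ℕ) : shK p k = (shK p 1) ^ k := by
  induction k with
  | zero => ext x <;> simp [shK]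
  | succ k ih =>
    rw [pow_succ, ← ih]
    ext x <;> simp [shK, Equiv.Perm.mul_def] <;> ring

/-- the bit maps `(g, a, b) ↦ (g, a + 1 + β, b + β)` (`bitVal β = β.toNat`). -/
def bitEq (β : Bool) : St p ≃ St p where
  toFun x := (x.1, x.2.1 + ((1 + β.toNat : ℕ) : ZMod 3), x.2.2 + ((β.toNat : ℕ) : ZMod p))
  invFun x := (x.1, x.2.1 - ((1 + β.toNat : ℕ) : ZMod 3), x.2.2 - ((β.toNat : ℕ) : ZMod p))
  left_inv x := by simp
  right_inv x := by simp

/-- the bit map, unfolded. -/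
theorem bitEq_apply (β : Bool) (x : St p) :
    bitEq p β x = (x.1, x.2.1 + ((1 + β.toNat : ℕ) : ZMod 3), x.2.2 + ((β.toNat : ℕ) : ZMod p)) := rfl

/-- the inverse bit map, unfolded. -/
theorem bitEq_symm_apply (β : Bool) (x : St p) :
    (bitEq p β).symm x = (x.1, x.2.1 - ((1 + β.toNat : ℕ) : ZMod 3), x.2.2 - ((β.toNat : ℕ) : ZMod p)) := rfl

/-- `bit₁⁻¹ ∘ bit₀ = Δ⁻¹`: the two bit maps differ by the unit shift. -/
theorem bitEq_true_symm_bitEq_false (x : St p) : (bitEq p true).symm (bitEq p false x) = (shK p 1).symm x := by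
  rcases x with ⟨g, a, b⟩
  simp only [bitEq_apply, bitEq_symm_apply, shK_symm_apply, Bool.toNat_false, Bool.toNat_true, add_zero,
    Nat.cast_one, Nat.cast_zero, Prod.mk.injEq, true_and]
  constructor
  · ring
  · simp

/-! ## §3 The translate family `𝓛` -/

/-- index of a member of `𝓛`: `(κ, ε)` with `ε = none ↦ 0`, `some r ↦ 1 − δ_r`. -/
abbrev Idx := ZMod 3 × Option (ZMod 3)

/-- the pattern value `ε(a)`. -/
def patVal : Option (ZMod 3) → ZMod 3 → Bool
  | none, _ => false
  | some r, a => decide (a ≠ r)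

/-- membership of `(g, a)` in `L_{κ,ε}`: `ev g (κ − a) = ε a`. -/
def mem (i : Idx) (g : Bool × Bool) (a : ZMod 3) : Bool := ev g (i.1 - a) == patVal i.2 a

/-- the label shift of an index: `(g, a + k) ∈ L_i ⟺ (g, a) ∈ L_{shIdx k i}`. -/
def shIdx (k : ZMod 3) (i : Idx) : Idx := (i.1 - k, i.2.map fun r => r - k)

/-- the toggle of an index: `(tog a g, a) ∈ L_i ⟺ (g, a) ∈ L_{togIdx i}`. -/
def togIdx (i : Idx) : Idx :=
  match i.2 with
  | none => (i.1, some (2 * i.1))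
  | some r => if r = 2 * i.1 then (i.1, none) else (i.1, some (2 * r + i.1))

/-- label shifts act on `𝓛`. -/
theorem mem_shIdx (k : ZMod 3) (i : Idx) (g : Bool × Bool) (a : ZMod 3) :
    mem (shIdx k i) g a = mem i g (a + k) := by
  revert k i g a; decide

/-- toggles act on `𝓛`. -/
theorem mem_togIdx (i : Idx) (g : Bool × Bool) (a : ZMod 3) : mem (togIdx i) g a = mem i (tog a g) a := by
  revert i g a; decide

/-- the toggle of indices is an involution. -/
theorem togIdx_togIdx (i : Idx) : togIdx (togIdx i) = i := by
  revert i; decide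

/-- **the two-block lemma**: every member of `𝓛` meets every coset `{(g, a) : a ∈ ℤ/3}`. -/
theorem exists_mem_idx (i : Idx) (g : Bool × Bool) : ∃ a : ZMod 3, mem i g a = true := by
  revert i g; decide

/-! ## §4 The functional `Φ` -/

variable {p}

/-- mass of `L_i × {b}` under `μ`. -/
def mass (μ : St p → ℝ) (i : Idx) (b : ZMod p) : ℝ :=
  ∑ g : Bool × Bool, ∑ a : ZMod 3, if mem i g a then μ (g, a, b) else 0

/-- `Φ μ = Σ_b min_{L ∈ 𝓛} μ(L × {b})`. -/
noncomputable def phi [NeZero p] (μ : St p → ℝ) : ℝ :=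
  ∑ b : ZMod p, (univ : Finset Idx).inf' ⟨(0, none), mem_univ _⟩ fun i => mass μ i b

/-- a sum over the state space, fibred by the counter. -/
theorem sum_St [NeZero p] (f : St p → ℝ) :
    ∑ x, f x = ∑ b : ZMod p, ∑ g : Bool × Bool, ∑ a : ZMod 3, f (g, a, b) := by
  rw [Fintype.sum_prod_type]
  have h : ∀ g : Bool × Bool, ∑ ab : ZMod 3 × ZMod p, f (g, ab) = ∑ b : ZMod p, ∑ a : ZMod 3, f (g, a, b) := by
    intro g; rw [Fintype.sum_prod_type, Finset.sum_comm]
  simp only [h]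
  rw [Finset.sum_comm]

/-- masses of two laws differ by at most the fibre's `ℓ¹` distance. -/
theorem abs_mass_sub_mass_le (μ ν : St p → ℝ) (i : Idx) (b : ZMod p) :
    |mass μ i b - mass ν i b| ≤ ∑ g : Bool × Bool, ∑ a : ZMod 3, |μ (g, a, b) - ν (g, a, b)| := by
  unfold mass
  rw [← sum_sub_distrib]
  refine (abs_sum_le_sum_abs _ _).trans (sum_le_sum fun g _ => ?_)
  rw [← sum_sub_distrib]
  refine (abs_sum_le_sum_abs _ _).trans (sum_le_sum fun a _ => ?_)
  split_ifs <;> simp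

/-- an infimum over a finite index set moves by at most the sup of the pointwise differences. -/
theorem inf'_sub_inf'_le {ι : Type*} (s : Finset ι) (hs : s.Nonempty) (F G : ι → ℝ) (M : ℝ)
    (h : ∀ i ∈ s, |F i - G i| ≤ M) : |s.inf' hs F - s.inf' hs G| ≤ M := by
  obtain ⟨i, hi, hFi⟩ := exists_mem_eq_inf' hs F
  obtain ⟨j, hj, hGj⟩ := exists_mem_eq_inf' hs G
  rw [abs_le]
  constructor
  · -- inf F ≥ inf G − M : inf F = F i ≥ G i − M ≥ inf G − M
    have h1 : s.inf' hs G ≤ G i := inf'_le _ hi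
    have h2 := (abs_le.mp (h i hi)).1
    linarith
  · have h1 : s.inf' hs F ≤ F j := inf'_le _ hj
    have h2 := (abs_le.mp (h j hj)).2
    linarith

/-- **`Φ` is `ℓ¹`-Lipschitz.** -/
theorem abs_phi_sub_phi_le [NeZero p] (μ ν : St p → ℝ) : |phi μ - phi ν| ≤ l1 μ ν := by
  unfold phi l1
  rw [← sum_sub_distrib, sum_St]
  refine (abs_sum_le_sum_abs _ _).trans (sum_le_sum fun b _ => ?_)
  exact inf'_sub_inf'_le _ _ _ _ _ fun i _ => abs_mass_sub_mass_le μ ν i b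

/-- an infimum over `univ` is invariant under reindexing by a bijection. -/
theorem inf'_comp_equiv {ι : Type*} [Fintype ι] (h : (univ : Finset ι).Nonempty) (e : ι ≃ ι) (F : ι → ℝ) :
    univ.inf' h (fun i => F (e i)) = univ.inf' h F := by
  apply le_antisymm
  · exact le_inf' _ _ fun j _ => (inf'_le _ (mem_univ (e.symm j))).trans (by simp)
  · exact le_inf' _ _ fun i _ => inf'_le _ (mem_univ (e i))

/-- the toggle of indices as a bijection. -/
def togEquiv : Idx ≃ Idx := Function.Involutive.toPerm togIdx togIdx_togIdx

/-- **fire invariance**: toggling a whole fibre permutes the masses of `𝓛` (by `togIdx`). -/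
theorem mass_fire (μ : St p → ℝ) (i : Idx) (b : ZMod p) :
    mass (fun x => μ (tog x.2.1 x.1, x.2.1, x.2.2)) i b = mass μ (togIdx i) b := by
  unfold mass
  rw [Finset.sum_comm, Finset.sum_comm (f := fun g a => if mem (togIdx i) g a = true then μ (g, a, b) else 0)]
  refine sum_congr rfl fun a _ => ?_
  -- reindex `g ↦ tog a g` (an involution)
  rw [← Equiv.sum_comp (Function.Involutive.toPerm (tog a) (tog_tog a))
    (fun g => if mem (togIdx i) g a = true then μ (g, a, b) else 0)]
  refine sum_congr rfl fun g _ => ?_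
  simp only [Function.Involutive.coe_toPerm, mem_togIdx, tog_tog]

/-- **`Φ` is invariant under a fibre-wise fire** (fibres `b` with `F b` toggled, the rest untouched). -/
theorem phi_fire [NeZero p] (μ : St p → ℝ) (F : ZMod p → Bool) :
    phi (fun x => μ (if F x.2.2 then tog x.2.1 x.1 else x.1, x.2.1, x.2.2)) = phi μ := by
  unfold phi
  refine sum_congr rfl fun b _ => ?_
  cases hb : F b
  · simp only [mass, hb, if_false, Bool.false_eq_true]
  · have hm : ∀ i, mass (fun x : St p => μ (if F x.2.2 then tog x.2.1 x.1 else x.1, x.2.1, x.2.2)) i b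
        = mass μ (togEquiv i) b := by
      intro i
      show _ = mass μ (togIdx i) b
      rw [← mass_fire]
      simp only [mass, hb, if_true]
    simp only [hm]
    exact inf'_comp_equiv _ togEquiv (fun i => mass μ i b)

/-- the label shift of indices as a bijection. -/
def shEquiv (k : ZMod 3) : Idx ≃ Idx where
  toFun := shIdx k
  invFun := shIdx (-k)
  left_inv i := by rcases i with ⟨κ, _ | r⟩ <;> simp [shIdx]
  right_inv i := by rcases i with ⟨κ, _ | r⟩ <;> simp [shIdx]

/-- mass after relabelling `a ↦ a + k` inside a fibre. -/
theorem mass_shift (μ : St p → ℝ) (k : ZMod 3) (i : Idx) (b' : ZMod p) :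
    (∑ g : Bool × Bool, ∑ a : ZMod 3, if mem i g a then μ (g, a - k, b') else 0) = mass μ (shIdx k i) b' := by
  unfold mass
  refine sum_congr rfl fun g _ => ?_
  rw [← Equiv.sum_comp (Equiv.subRight k) (fun a => if mem (shIdx k i) g a = true then μ (g, a, b') else 0)]
  refine sum_congr rfl fun a _ => ?_
  simp only [Equiv.subRight_apply, mem_shIdx, sub_add_cancel]

/-- **`Φ` does not decrease under the bit step** `μ' (g,a,b) = ½(μ(g,a−1,b) + μ(g,a−2,b−1))`. -/
theorem phi_bit_le [NeZero p] (μ : St p → ℝ) :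
    phi μ ≤ phi (fun x => (μ (x.1, x.2.1 - 1, x.2.2) + μ (x.1, x.2.1 - 2, x.2.2 - 1)) / 2) := by
  unfold phi
  set m : ZMod p → ℝ := fun b => univ.inf' ⟨(0, none), mem_univ _⟩ fun i => mass μ i b with hm
  have hsplit : ∀ i b, mass (fun x : St p => (μ (x.1, x.2.1 - 1, x.2.2) + μ (x.1, x.2.1 - 2, x.2.2 - 1)) / 2) i b
      = (mass μ (shIdx 1 i) b + mass μ (shIdx 2 i) (b - 1)) / 2 := by
    intro i b
    rw [← mass_shift μ 1 i b, ← mass_shift μ 2 i (b - 1)]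
    unfold mass
    rw [← sum_add_distrib, sum_div]
    refine sum_congr rfl fun g _ => ?_
    rw [← sum_add_distrib, sum_div]
    refine sum_congr rfl fun a _ => ?_
    split_ifs <;> ring
  have hlow : ∀ b, (m b + m (b - 1)) / 2
      ≤ univ.inf' ⟨(0, none), mem_univ _⟩ (fun i =>
          mass (fun x : St p => (μ (x.1, x.2.1 - 1, x.2.2) + μ (x.1, x.2.1 - 2, x.2.2 - 1)) / 2) i b) := by
    intro b
    refine le_inf' _ _ fun i _ => ?_
    rw [hsplit]
    have h1 : m b ≤ mass μ (shIdx 1 i) b := inf'_le _ (mem_univ _)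
    have h2 : m (b - 1) ≤ mass μ (shIdx 2 i) (b - 1) := inf'_le _ (mem_univ _)
    linarith
  have hs : ∑ b : ZMod p, m (b - 1) = ∑ b, m b := Equiv.sum_comp (Equiv.subRight (1 : ZMod p)) m
  calc ∑ b, m b = (∑ b, m b + ∑ b, m (b - 1)) / 2 := by rw [hs]; ring
    _ = ∑ b, (m b + m (b - 1)) / 2 := by rw [← sum_div, sum_add_distrib]
    _ ≤ _ := sum_le_sum fun b _ => hlow b

/-- **two-block bound**: if every fibre of `μ` is nonnegative and constant in the label, then `Φ μ ≥ (Σ μ)/3`. -/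
theorem phi_ge_third [NeZero p] (μ : St p → ℝ) (hμ : ∀ x, 0 ≤ μ x) (hconst : ∀ g a b, μ (g, a, b) = μ (g, 0, b)) :
    (∑ x, μ x) / 3 ≤ phi μ := by
  unfold phi
  rw [sum_St, sum_div]
  refine sum_le_sum fun b _ => le_inf' _ _ fun i _ => ?_
  unfold mass
  rw [sum_div]
  refine sum_le_sum fun g _ => ?_
  obtain ⟨a₀, ha₀⟩ := exists_mem_idx i g
  have hsum : ∑ a : ZMod 3, μ (g, a, b) = 3 * μ (g, 0, b) := by
    rw [sum_congr rfl fun a _ => hconst g a b, sum_const, card_univ, ZMod.card, nsmul_eq_mul, Nat.cast_ofNat]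
  calc (∑ a : ZMod 3, μ (g, a, b)) / 3 = μ (g, a₀, b) := by rw [hsum, hconst g a₀ b]; ring
    _ = (if mem i g a₀ = true then μ (g, a₀, b) else 0) := by rw [if_pos ha₀]
    _ ≤ ∑ a : ZMod 3, if mem i g a = true then μ (g, a, b) else 0 :=
        single_le_sum (f := fun a => if mem i g a = true then μ (g, a, b) else 0)
          (fun a _ => by split_ifs <;> simp [hμ]) (mem_univ a₀)

/-- the LOSE count dominates `Φ`: for the index `i₀ ∈ 𝓛`, `Σ_b μ(L_{i₀} × {b}) ≥ Φ μ`. -/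
theorem phi_le_mass_sum [NeZero p] (μ : St p → ℝ) (i₀ : Idx) : phi μ ≤ ∑ b : ZMod p, mass μ i₀ b :=
  sum_le_sum fun _ _ => inf'_le _ (mem_univ i₀)

end Summit.QuantumAdvantage.AdviceFreeQNC0.CounterLaw
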